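import Summits.ValiantsHypothesis.ValiantsHypothesis.Theorems.LacunarySymmetroidMatrixDescartesDoorA26WallBubblingWeylTripleLimit
import Summits.ValiantsHypothesis.ValiantsHypothesis.Theorems.LacunarySymmetroidMatrixDescartesDoorA26WallBubblingConfluentClusters

/-!
# Wall bubbling for `DoorA26` — WEYL TRIPLES: ALL CLUSTERS OF A SEQUENCE OF TWENTIES ALONG ONE SUBSEQUENCE (function-level packages)

HONEST FRAMING.  Chain lemma toward `TripleStratum26` of `Cruxes/DoorA26/Lines/wall_bubbling_ConfluentDoor.lean` (rev 13; crux `DoorA26`,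
stmt-ValiantsHypothesis-19979 — OPEN, typed, never asserted), pattern [3,1,1,1] (triple at `3,4,5`).  W1 seat val-sym-door-p2 g15 (#112): the port of
W2's `confluentClusters` (one-pair, Gram-normalised frames) to the FUNCTION-LEVEL CLASS-MOMENT currency of #89 `weylTripleLimit` — the first input of
the OPEN multi-cluster (spread) case `s3111` of #111 `tripleStratum26_of_spreadChains` (memo TRIPLE-STRATUM-g15 §3).  Pure bookkeeping: `blocks`
(Bolzano–Weierstrass on the gaps), `pencil_recenter`, the hereditary extraction `exists_strictMono_forall_lt`, and #89 applied at every cluster centre.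

* **`weylTripleClusters`** — for twenties `z ν` of pencils `Σ_l e^{δs ν l·t}U ν l` with `δs ν → δ0` at a Weyl triple (`δ0 4 = δ0 5 = δ0 3`): along ONE
  subsequence `φ` there are `C` clusters with sizes `m c ≥ 1`, `Σ m c = 20`, centres `s c k` drifting apart, the `m c` zeros of cluster `c` recentred at
  `s c k` in a common window `[−R, R]`, and — chosen for all clusters at once — the packages of #89 for the recentred letters `e^{δ_l s_c}U_l`:
  normalisers `a c`, symmetric limit coefficients `coef c` (orders `< 6 / 3 / 1` on the ordered classes `Fin 4 × Fin 4`), one of them non-zero, the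
  RIGIDITY DICHOTOMY at every cluster, and continuous convergence with all derivatives to the cluster's limit function along every further subsequence.

Nothing here bears on `DoorA26`, `MatrixDescartes` (stmt-ValiantsHypothesis-18050) or `VP ≠ VNP`; `TripleStratum26`, (W), (M) OPEN.
`--supports stmt-ValiantsHypothesis-19979 --as helper`.  [this work] bookkeeping; [folklore] Bolzano–Weierstrass.
-/

-- `Summit.ValiantsHypothesis.ValiantsHypothesis.…` repeats a component by the D-0017 layout
-- (single-conjunct summit), which the `dupNamespace` linter flags; the name is mandated.
set_option linter.dupNamespace false

namespace Summit.ValiantsHypothesis.ValiantsHypothesis.Theorems.LacunarySymmetroidMatrixDescartes.WallBubbling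

open Finset Filter Topology
open Bubbling (blocks)
open scoped BigOperators

/-- **ALL CLUSTERS OF A SEQUENCE OF TWENTIES AT A WEYL TRIPLE, ALONG ONE SUBSEQUENCE, WITH THEIR FUNCTION-LEVEL PACKAGES.**  See the module
docstring. [this work] -/
theorem weylTripleClusters (δs : ℕ → Fin 6 → ℝ) (δ0 : Fin 6 → ℝ)
    (hδ : ∀ l, Tendsto (fun ν => δs ν l) atTop (𝓝 (δ0 l))) (h43 : δ0 4 = δ0 3) (h53 : δ0 5 = δ0 3)
    (U : ℕ → Fin 6 → Matrix (Fin 2) (Fin 2) ℝ) (hU : ∀ ν l, (U ν l).IsSymm)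
    (hne : ∀ ν, ∃ t, (∑ l, Real.exp (δs ν l * t) • U ν l).det ≠ 0)
    (z : ℕ → Fin 20 → ℝ) (hz : ∀ ν, StrictMono (z ν)) (hroot : ∀ ν i, (∑ l, Real.exp (δs ν l * z ν i) • U ν l).det = 0) :
    ∃ φ : ℕ → ℕ, StrictMono φ ∧
    ∃ (C : ℕ) (m : Fin C → ℕ) (s : Fin C → ℕ → ℝ) (R : ℝ),
      ∑ c, m c = 20 ∧ (∀ c, 1 ≤ m c) ∧
      (∀ c c' : Fin C, c < c' → Tendsto (fun k => s c' k - s c k) atTop atTop) ∧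
      (∀ (c : Fin C) (k : ℕ), ∃ x : Fin (m c) → ℝ, StrictMono x ∧ ∀ i, x i ∈ Set.Icc (-R) R ∧
        (∑ l, Real.exp (δs (φ k) l * x i) • (Real.exp (δs (φ k) l * s c k) • U (φ k) l)).det = 0) ∧
      ∃ (a : Fin C → ℕ → ℝ) (coef : Fin C → Fin 4 × Fin 4 → ℕ → ℝ), ∀ c : Fin C,
        (∀ k m, coef c k.swap m = coef c k m) ∧
        (∃ k m, m < (fun k : Fin 4 × Fin 4 => if k.1 = 3 ∧ k.2 = 3 then 6 else if k.1 = 3 ∨ k.2 = 3 then 3 else 1) k ∧ coef c k m ≠ 0) ∧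
        (coef c (3, 3) 5 = 0 ∨ ∀ k : Fin 4 × Fin 4, k.1 ≠ 3 → k.2 ≠ 3 → coef c k 0 = 0) ∧
        ∀ (j : ℕ) (ψ : ℕ → ℕ), StrictMono ψ → ∀ (ts : ℕ → ℝ) (t₀ : ℝ), Tendsto ts atTop (𝓝 t₀) →
          Tendsto (fun l => iteratedDeriv j (fun t => a c (ψ l) *
              (∑ i, Real.exp (δs (φ (ψ l)) i * t) • (Real.exp (δs (φ (ψ l)) i * s c (ψ l)) • U (φ (ψ l)) i)).det) (ts l))
            atTop (𝓝 (iteratedDeriv j (fun s' => ∑ k : Fin 4 × Fin 4,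
              (∑ m ∈ Finset.range ((fun k : Fin 4 × Fin 4 => if k.1 = 3 ∧ k.2 = 3 then 6 else if k.1 = 3 ∨ k.2 = 3 then 3 else 1) k),
                coef c k m * s' ^ m / (m.factorial : ℝ))
                * Real.exp ((δ0 k.1.castSucc.castSucc + δ0 k.2.castSucc.castSucc) * s')) t₀)) := by
  classical
  -- (1) blocks
  obtain ⟨φ₁, hφ₁, C, start, blk, R, hstart, hblk, hwin, hdrift⟩ := blocks z hz
  -- (2) the hereditary per-cluster property: the package of #89 for the letters recentred at the start of block `c`, along `φ₁ ∘ χ`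
  let P : ℕ → (ℕ → ℕ) → Prop := fun c χ => ∀ hc : c < C,
    ∃ (a : ℕ → ℝ) (coef : Fin 4 × Fin 4 → ℕ → ℝ),
      (∀ k m, coef k.swap m = coef k m) ∧
      (∃ k m, m < (fun k : Fin 4 × Fin 4 => if k.1 = 3 ∧ k.2 = 3 then 6 else if k.1 = 3 ∨ k.2 = 3 then 3 else 1) k ∧ coef k m ≠ 0) ∧
      (coef (3, 3) 5 = 0 ∨ ∀ k : Fin 4 × Fin 4, k.1 ≠ 3 → k.2 ≠ 3 → coef k 0 = 0) ∧
      ∀ (j : ℕ) (ψ : ℕ → ℕ), StrictMono ψ → ∀ (ts : ℕ → ℝ) (t₀ : ℝ), Tendsto ts atTop (𝓝 t₀) →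
        Tendsto (fun l => iteratedDeriv j (fun t => a (ψ l) *
            (∑ i, Real.exp (δs (φ₁ (χ (ψ l))) i * t) •
              (Real.exp (δs (φ₁ (χ (ψ l))) i * z (φ₁ (χ (ψ l))) (start ⟨c, hc⟩)) • U (φ₁ (χ (ψ l))) i)).det) (ts l))
          atTop (𝓝 (iteratedDeriv j (fun s' => ∑ k : Fin 4 × Fin 4,
            (∑ m ∈ Finset.range ((fun k : Fin 4 × Fin 4 => if k.1 = 3 ∧ k.2 = 3 then 6 else if k.1 = 3 ∨ k.2 = 3 then 3 else 1) k),
              coef k m * s' ^ m / (m.factorial : ℝ))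
              * Real.exp ((δ0 k.1.castSucc.castSucc + δ0 k.2.castSucc.castSucc) * s')) t₀))
  have hher : ∀ c (χ ψ : ℕ → ℕ), StrictMono ψ → P c χ → P c (χ ∘ ψ) := by
    intro c χ ψ hψ hP hc
    obtain ⟨a, coef, h1, h2, h3, h4⟩ := hP hc
    refine ⟨fun k => a (ψ k), coef, h1, h2, h3, ?_⟩
    intro j ψ' hψ' ts t₀ hts
    exact h4 j (ψ ∘ ψ') (hψ.comp hψ') ts t₀ hts
  have hatt : ∀ c (χ : ℕ → ℕ), StrictMono χ → ∃ ψ : ℕ → ℕ, StrictMono ψ ∧ P c (χ ∘ ψ) := by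
    intro c χ hχ
    by_cases hc : c < C
    · have hχ' : Tendsto (fun ν => φ₁ (χ ν)) atTop atTop := hφ₁.tendsto_atTop.comp hχ.tendsto_atTop
      obtain ⟨ψ, hψ, a, coef, h1, h2, h3, h4⟩ := weylTripleLimit
        (fun ν l => δs (φ₁ (χ ν)) l) δ0 (fun l => (hδ l).comp hχ') h43 h53
        (fun ν l => Real.exp (δs (φ₁ (χ ν)) l * z (φ₁ (χ ν)) (start ⟨c, hc⟩)) • U (φ₁ (χ ν)) l)
        (fun ν l => ((hU (φ₁ (χ ν)) l).smul _))
        (by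
          intro ν
          obtain ⟨t, ht⟩ := hne (φ₁ (χ ν))
          refine ⟨t - z (φ₁ (χ ν)) (start ⟨c, hc⟩), ?_⟩
          rw [← pencil_recenter, add_sub_cancel]
          exact ht)
      refine ⟨ψ, hψ, fun hc' => ⟨a, coef, h1, h2, h3, ?_⟩⟩
      intro j ψ' hψ' ts t₀ hts
      exact h4 j ψ' hψ' ts t₀ hts
    · exact ⟨id, strictMono_id, fun hc' => absurd hc' hc⟩
  obtain ⟨χ, hχ, hP⟩ := exists_strictMono_forall_lt C P hher hatt id strictMono_id
  -- (3) assemble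
  have hφ : StrictMono (fun k => φ₁ (χ k)) := hφ₁.comp hχ
  let m : Fin C → ℕ := fun c => (univ.filter fun j : Fin 20 => blk j = c).card
  have hm : ∑ c, m c = 20 := by
    have := (Finset.card_eq_sum_card_fiberwise (s := (univ : Finset (Fin 20))) (t := (univ : Finset (Fin C))) (f := blk)
      (fun j _ => Finset.mem_univ _)).symm
    rw [Finset.card_univ, Fintype.card_fin] at this
    exact this
  have hblkstart : ∀ c, blk (start c) = c := by
    intro c
    rcases lt_trichotomy (blk (start c)) c with hlt | heq | hgt
    · exfalso
      have hev := (hdrift _ _ hlt).eventually_gt_atTop R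
      obtain ⟨ν, hν⟩ := hev.exists
      have hw := (hwin ν (start c)).2
      exact absurd hw (not_le.mpr hν)
    · exact heq
    · exact absurd (hblk (start c)) (not_le.mpr (hstart hgt))
  have hmpos : ∀ c, 1 ≤ m c := fun c =>
    Finset.card_pos.mpr ⟨start c, Finset.mem_filter.mpr ⟨Finset.mem_univ _, hblkstart c⟩⟩
  refine ⟨fun k => φ₁ (χ k), hφ, C, m, fun c k => z (φ₁ (χ k)) (start c), R, hm, hmpos, ?_, ?_, ?_⟩
  · intro c c' hcc'
    exact (hdrift c c' hcc').comp hχ.tendsto_atTop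
  · intro c k
    set J : Finset (Fin 20) := univ.filter fun j : Fin 20 => blk j = c with hJ
    have hJcard : J.card = m c := rfl
    let e : Fin (m c) ↪o Fin 20 := J.orderEmbOfFin hJcard
    have heJ : ∀ i, e i ∈ J := fun i => Finset.orderEmbOfFin_mem J hJcard i
    refine ⟨fun i => z (φ₁ (χ k)) (e i) - z (φ₁ (χ k)) (start c), ?_, fun i => ⟨?_, ?_⟩⟩
    · intro i j hij
      exact sub_lt_sub_right (hz _ (e.strictMono hij)) _
    · have hblkc : blk (e i) = c := (Finset.mem_filter.mp (heJ i)).2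
      have := hwin (χ k) (e i)
      rw [hblkc] at this
      exact this
    · rw [← pencil_recenter, add_sub_cancel]
      exact hroot _ _
  · choose a coef hpkg using fun c : Fin C => hP c.val c.isLt c.isLt
    exact ⟨a, coef, hpkg⟩

end Summit.ValiantsHypothesis.ValiantsHypothesis.Theorems.LacunarySymmetroidMatrixDescartes.WallBubbling
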